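import Summits.CriticalPhenomena.PercolationContinuityZ3.Theorems.PercNearOneGluingNoHeavyLowerTailCubicFourPointL1Relabel
import Summits.CriticalPhenomena.PercolationContinuityZ3.Theorems.PercNearOneGluingNoHeavyLowerTailHybridThreePointLB
import HarnessLib

/-!
# `NoHeavyLowerTail` (stmt-CriticalPhenomena-4575) — (L1) in the deletion–contraction calculus: the two hybrid Richards–Sahi rows
# `E1 = E₃(D_bc, D_ac, G_ab)` and `E2 = E₃(D_bc, G_ac, D_ab)` are NONNEGATIVE for EVERY edge system (all graphs, all weights, all forced sets, all labels)

Support file (prover seat `prim-bnk-1`; `--supports stmt-CriticalPhenomena-4575`).  No definitions, no named facts, no sorries, no `native_decide`; standard axioms.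

(L1) is `E1 + E2 ≥ β·P(b≁c)` (`HybMasses.L1_eq`).  Since 2026-08-19T23:20Z the two hybrid rows are THEOREMS on every finite weighted graph:
`E1 = E₃({b≁c},{c≁a},{b≁{a,y}})` is the instance `P₁ = {b}`, pole `c`, `P₃ = {a} ⊆ P₃' = {a,y}` of prim-ineq-gen-8 / prim-cert-2's HYBRID three-point
lower bound `HybridThreePointLB.hybrid_PrW` (finitary form of `HybridThreePointLB.sahiE3_hybrid_nonneg`, four-switching proof after prim-lit-2's 3PT-LB), and `E2`
is its `b ↔ c` mirror (pole `b`, `P₁ = {c}`).  This file carries them into prim-l12-p2's closure-calculus vocabulary (`CubicFourPointL1.massesW D p K a b c y`,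
random edges `D`, FORCED edges `K`, arbitrary vertex type), where they were so far available only as LP dictionary rows:

* `sep_comm`, `gconn_singleton_compl`, `gconn_pair_compl` — dictionary between `HybridThreePointLB.gconn` (group connection, no forced edges) and p2's
  `sep ∅` events;
* `E1_nonneg_univ`, `E2_nonneg_univ` — the rows for the all-coordinates system `(univ, p, ∅)` on a finite vertex type (direct from `hybrid_PrW`);
* **`E1_nonneg_of_fintype`, `E2_nonneg_of_fintype`** — every `D, K, p ∈ [0,1]`, every `a b c y` (coincidences allowed) on a finite vertex type, via
  `massesW_eq_univ` (forced edges = weight-one coordinates; p201139);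
* **`E1_nonneg`, `E2_nonneg`** — arbitrary vertex type: every system whose edges and labels lie in a finite vertex set `T` (no bound on `|T|`), via the
  injective-relabelling transport `massesW_image` (p201292);
* `l1W_add_beta_bc_nonneg` — hence `L1 + β·P(b≁c) = E1 + E2 ≥ 0` everywhere: what remains of (L1) is exactly the subtracted term `β·P(b≁c)`.
[cite: Grimmett1999, §2.2 (product measure; cylinder events)]; [cite: GladkovZimin2024HK, §4 (switching lemma behind the hybrid 3PT-LB)]
-/

noncomputable section

namespace Summit.CriticalPhenomena.PercolationContinuityZ3.Theorems

namespace CubicFourPointL1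

open Finset SimpleGraph Literature.Probability.Percolation Literature.Probability.Percolation.DecisionTree
open Literature.Probability.Percolation.Gladkov CubicThreePointStep TerminalGluing HybridThreePointLB
open scoped Classical

variable {V : Type*} [DecidableEq V]

/-! ### Dictionary: `gconn` (no forced edges) versus `sep ∅` -/

/-- Separation is symmetric: `sep K x y = sep K y x`. [folklore] -/
theorem sep_comm (K : Finset (Sym2 V)) (x y : V) : sep K x y = sep K y x := by
  ext S
  simp only [mem_sep]
  exact not_congr ⟨fun h => h.symm, fun h => h.symm⟩

section Fintype

variable [Fintype V]

omit [Fintype V] in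
/-- `R ∅ S x y` is reachability in the open graph of `S`. [folklore] -/
theorem R_empty_iff_reachable (S : Finset (Sym2 V)) (x y : V) :
    R ∅ S x y ↔ (openGraph (↑S : Set (Sym2 V))).Reachable x y := by
  rw [R_empty_iff]; rfl

/-- The complement of the group connection `{c} ~ {b}` is the separation event `sep ∅ c b`. [folklore] -/
theorem gconn_singleton_compl (c b : V) : (gconn ({c} : Finset V) ({b} : Finset V))ᶜ = sep ∅ c b := by
  ext S
  simp only [Set.mem_compl_iff, mem_gconn, Finset.mem_singleton, exists_eq_left, mem_cl, mem_sep, R_empty_iff_reachable]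

/-- The complement of the group connection `{a,y} ~ {b}` is `sep ∅ a b ∩ sep ∅ b y`. [folklore] -/
theorem gconn_pair_compl (a y b : V) : (gconn ({a, y} : Finset V) ({b} : Finset V))ᶜ = sep ∅ a b ∩ sep ∅ b y := by
  ext S
  simp only [Set.mem_compl_iff, mem_gconn, Finset.mem_insert, Finset.mem_singleton, exists_eq_left, mem_cl, Set.mem_inter_iff, mem_sep,
    R_empty_iff_reachable, exists_eq_or_imp, not_or]
  exact and_congr Iff.rfl (not_congr ⟨fun h => h.symm, fun h => h.symm⟩)

/-! ### The rows for the all-coordinates system -/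

/-- **`E1 ≥ 0` for the system `(univ, p, ∅)`** on a finite vertex type (hybrid 3PT-LB with `P₁ = {b}`, pole `c`, `P₃ = {a} ⊆ P₃' = {a,y}`). [folklore] -/
theorem E1_nonneg_univ (p : Sym2 V → ℝ) (hp0 : ∀ e, 0 ≤ p e) (hp1 : ∀ e, p e ≤ 1) (a b c y : V) :
    0 ≤ (massesW Finset.univ p ∅ a b c y).E1 := by
  have h := hybrid_PrW hp0 hp1 Finset.univ c ({b} : Finset V) ({a} : Finset V) ({a, y} : Finset V)
    (Finset.singleton_subset_iff.2 (Finset.mem_insert_self a {y}))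
  rw [gconn_singleton_compl, gconn_singleton_compl, gconn_pair_compl, sep_comm ∅ c b, sep_comm ∅ c a] at h
  simp only [massesW, HybMasses.E1, HybMasses.E3h]
  linarith [h]

/-- **`E2 ≥ 0` for the system `(univ, p, ∅)`** on a finite vertex type (hybrid 3PT-LB with `P₁ = {c}`, pole `b`, `P₃ = {a} ⊆ P₃' = {a,y}`). [folklore] -/
theorem E2_nonneg_univ (p : Sym2 V → ℝ) (hp0 : ∀ e, 0 ≤ p e) (hp1 : ∀ e, p e ≤ 1) (a b c y : V) :
    0 ≤ (massesW Finset.univ p ∅ a b c y).E2 := by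
  have h := hybrid_PrW hp0 hp1 Finset.univ b ({c} : Finset V) ({a} : Finset V) ({a, y} : Finset V)
    (Finset.singleton_subset_iff.2 (Finset.mem_insert_self a {y}))
  rw [gconn_singleton_compl, gconn_singleton_compl, gconn_pair_compl, sep_comm ∅ b a] at h
  -- reorder the intersections to p2's field shapes
  have e3 : sep ∅ b c ∩ sep ∅ a b ∩ (sep ∅ a c ∩ sep ∅ c y) = (sep ∅ b c ∩ (sep ∅ a c ∩ sep ∅ c y)) ∩ sep ∅ a b := by
    ext S; simp only [Set.mem_inter_iff]; tauto
  have e2 : sep ∅ a b ∩ (sep ∅ a c ∩ sep ∅ c y) = (sep ∅ a c ∩ sep ∅ c y) ∩ sep ∅ a b := Set.inter_comm _ _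
  rw [e3, e2] at h
  simp only [massesW, HybMasses.E2, HybMasses.E3h]
  linarith [h]

/-! ### Every system on a finite vertex type -/

/-- **`E1 = E₃(D_bc, D_ac, G_ab) ≥ 0` for every edge system on a finite vertex type**: all random edges `D`, forced edges `K`, weights
`0 ≤ p ≤ 1`, labels `a b c y` (coincidences allowed). [folklore] -/
theorem E1_nonneg_of_fintype (D K : Finset (Sym2 V)) (p : Sym2 V → ℝ) (hp0 : ∀ e, 0 ≤ p e) (hp1 : ∀ e, p e ≤ 1) (a b c y : V) :
    0 ≤ (massesW D p K a b c y).E1 := by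
  rw [massesW_eq_univ D K p a b c y]
  refine E1_nonneg_univ _ (fun e => ?_) (fun e => ?_) a b c y
  · by_cases hK : e ∈ K
    · simp only [hK, if_true]; exact zero_le_one
    · by_cases hD : e ∈ D
      · simp only [hK, hD, if_false, if_true]; exact hp0 e
      · simp only [hK, hD, if_false]; exact le_rfl
  · by_cases hK : e ∈ K
    · simp only [hK, if_true]; exact le_rfl
    · by_cases hD : e ∈ D
      · simp only [hK, hD, if_false, if_true]; exact hp1 e
      · simp only [hK, hD, if_false]; exact zero_le_one

/-- **`E2 = E₃(D_bc, G_ac, D_ab) ≥ 0` for every edge system on a finite vertex type.** [folklore] -/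
theorem E2_nonneg_of_fintype (D K : Finset (Sym2 V)) (p : Sym2 V → ℝ) (hp0 : ∀ e, 0 ≤ p e) (hp1 : ∀ e, p e ≤ 1) (a b c y : V) :
    0 ≤ (massesW D p K a b c y).E2 := by
  rw [massesW_eq_univ D K p a b c y]
  refine E2_nonneg_univ _ (fun e => ?_) (fun e => ?_) a b c y
  · by_cases hK : e ∈ K
    · simp only [hK, if_true]; exact zero_le_one
    · by_cases hD : e ∈ D
      · simp only [hK, hD, if_false, if_true]; exact hp0 e
      · simp only [hK, hD, if_false]; exact le_rfl
  · by_cases hK : e ∈ K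
    · simp only [hK, if_true]; exact le_rfl
    · by_cases hD : e ∈ D
      · simp only [hK, hD, if_false, if_true]; exact hp1 e
      · simp only [hK, hD, if_false]; exact zero_le_one

end Fintype

/-! ### Arbitrary vertex type -/

/-- **`E1 ≥ 0` on an arbitrary vertex type**: every edge system whose edges and labels lie in a finite vertex set `T`. [folklore] -/
theorem E1_nonneg (T : Finset V) (D K : Finset (Sym2 V)) (p : Sym2 V → ℝ) (hp0 : ∀ e, 0 ≤ p e) (hp1 : ∀ e, p e ≤ 1)
    (hD : ∀ e ∈ D, ∀ v ∈ e, v ∈ T) (hK : ∀ e ∈ K, ∀ v ∈ e, v ∈ T)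
    (a b c y : V) (ha : a ∈ T) (hb : b ∈ T) (hc : c ∈ T) (hy : y ∈ T) :
    0 ≤ (massesW D p K a b c y).E1 := by
  let g : Fin T.card → V := fun i => ((T.equivFin.symm i : T) : V)
  have hg : Function.Injective g := fun i j h => T.equivFin.symm.injective (Subtype.ext h)
  have hrange : ∀ v ∈ T, v ∈ Set.range g := fun v hv =>
    ⟨T.equivFin ⟨v, hv⟩, by simp only [g, Equiv.symm_apply_apply]⟩
  obtain ⟨D₀, hD₀⟩ := exists_preimage_edges (φ := g) D fun e he v hv => hrange v (hD e he v hv)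
  obtain ⟨K₀, hK₀⟩ := exists_preimage_edges (φ := g) K fun e he v hv => hrange v (hK e he v hv)
  obtain ⟨a₀, ha₀⟩ := hrange a ha
  obtain ⟨b₀, hb₀⟩ := hrange b hb
  obtain ⟨c₀, hc₀⟩ := hrange c hc
  obtain ⟨y₀, hy₀⟩ := hrange y hy
  rw [← hD₀, ← hK₀, ← ha₀, ← hb₀, ← hc₀, ← hy₀, massesW_image hg]
  exact E1_nonneg_of_fintype D₀ K₀ (p ∘ Sym2.map g) (fun e => hp0 _) (fun e => hp1 _) a₀ b₀ c₀ y₀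

/-- **`E2 ≥ 0` on an arbitrary vertex type**: every edge system whose edges and labels lie in a finite vertex set `T`. [folklore] -/
theorem E2_nonneg (T : Finset V) (D K : Finset (Sym2 V)) (p : Sym2 V → ℝ) (hp0 : ∀ e, 0 ≤ p e) (hp1 : ∀ e, p e ≤ 1)
    (hD : ∀ e ∈ D, ∀ v ∈ e, v ∈ T) (hK : ∀ e ∈ K, ∀ v ∈ e, v ∈ T)
    (a b c y : V) (ha : a ∈ T) (hb : b ∈ T) (hc : c ∈ T) (hy : y ∈ T) :
    0 ≤ (massesW D p K a b c y).E2 := by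
  let g : Fin T.card → V := fun i => ((T.equivFin.symm i : T) : V)
  have hg : Function.Injective g := fun i j h => T.equivFin.symm.injective (Subtype.ext h)
  have hrange : ∀ v ∈ T, v ∈ Set.range g := fun v hv =>
    ⟨T.equivFin ⟨v, hv⟩, by simp only [g, Equiv.symm_apply_apply]⟩
  obtain ⟨D₀, hD₀⟩ := exists_preimage_edges (φ := g) D fun e he v hv => hrange v (hD e he v hv)
  obtain ⟨K₀, hK₀⟩ := exists_preimage_edges (φ := g) K fun e he v hv => hrange v (hK e he v hv)
  obtain ⟨a₀, ha₀⟩ := hrange a ha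
  obtain ⟨b₀, hb₀⟩ := hrange b hb
  obtain ⟨c₀, hc₀⟩ := hrange c hc
  obtain ⟨y₀, hy₀⟩ := hrange y hy
  rw [← hD₀, ← hK₀, ← ha₀, ← hb₀, ← hc₀, ← hy₀, massesW_image hg]
  exact E2_nonneg_of_fintype D₀ K₀ (p ∘ Sym2.map g) (fun e => hp0 _) (fun e => hp1 _) a₀ b₀ c₀ y₀

/-- **What remains of (L1)**: `L1 + β·P(b≁c) = E1 + E2 ≥ 0` for every edge system (arbitrary vertex type). [folklore] -/
theorem l1W_add_beta_bc_nonneg (T : Finset V) (D K : Finset (Sym2 V)) (p : Sym2 V → ℝ) (hp0 : ∀ e, 0 ≤ p e) (hp1 : ∀ e, p e ≤ 1)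
    (hD : ∀ e ∈ D, ∀ v ∈ e, v ∈ T) (hK : ∀ e ∈ K, ∀ v ∈ e, v ∈ T)
    (a b c y : V) (ha : a ∈ T) (hb : b ∈ T) (hc : c ∈ T) (hy : y ∈ T) :
    0 ≤ l1W D p K a b c y + (massesW D p K a b c y).β * (massesW D p K a b c y).bc := by
  have h1 := E1_nonneg T D K p hp0 hp1 hD hK a b c y ha hb hc hy
  have h2 := E2_nonneg T D K p hp0 hp1 hD hK a b c y ha hb hc hy
  rw [l1W, HybMasses.L1_eq]
  linarith

end CubicFourPointL1

end Summit.CriticalPhenomena.PercolationContinuityZ3.Theorems
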